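import Summits.QuantumFields.YangMills.Theorems.AlphaInputsT3ACv3AbelianLiftAvg
import Literature.MathematicalPhysics.QuantumFieldTheory.Balaban1983to89.AveragingRT
import HarnessLib

/-!
# Route `SmallFieldWidening`, crux r3 `LargeFieldMassRefinementTail` (stmt-QuantumFields-22884) — THE GAUSSIAN RUNG (BC5 first rung (ii) of the
# route, «the GAUSSIAN (lattice-Maxwell) instance of PerHeightLargeFieldFactor»; the route's cheapest falsifier (i) «K-uniformity of the
# block-averaged plaquette variance», run numerically as kit j291705 (sup = 2/3), here made a KERNEL THEOREM)

Width seat `ym-line-sfw-p2-w2` gen 3 (2026-08-28).  WHY.  Crux r3 (and the K2 core `AveragedTailAt` it is wired to) asks that the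
`s`-fold BLOCK-AVERAGED plaquette field of run `K` stays below Bałaban's threshold `θ(K−s) = g_{K−s}·p(g_{K−s})` except on a summable
mass, UNIFORMLY in `K` and the volume.  The typing is only sane if the natural size of an `s`-fold averaged plaquette is `g_{K−s} =
L^{s/2} g_K` and NOT larger — the route's kill criterion (i): «if the averaged-plaquette variance at the unit height grows with `K` the
threshold is crossed with probability not bounded `K`-uniformly and r3 is dead as typed».  In the linearised (abelian, lattice-Maxwell)
theory this is a statement about the (0.4) LINEAR averaging operator alone, and it is proved here exactly, for Bałaban's own averaging
of record (`AbelianEML.linAvg04` / `linAvgIter`, the tree's typing of [Balaban1987RG1] (0.4)):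

* §1 `curlAt_linAvg04_eq_sum` — ONE STEP: the curl of the (0.4) linear average at a coarse plaquette `(y; μ, ν)` is
  `|Idx|⁻¹ · Σ_{r} Σ_{e} curl a (x(y,r) + t e_ν + s e_μ)` over block offsets `r ∈ {0..L-1}^d` and digits `e = (orderings, (t, s))`
  (the tree's `curl_linAvg04` + abelian Stokes `rectSum_eq_sum_curl`, re-indexed); `step_injective` — for a fixed digit `e` the map
  `(y, r) ↦ x(y,r) + t e_ν + s e_μ` is INJECTIVE (block decomposition `AveragingRT.blockSite_inj` + torus translations).
* §2 ★★ `exists_weight` — `s` STEPS (standing range `s ≤ m + K`): there is a weight `V : Site P s → Site P 0 → ℝ` with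
  `curl (linAvgIter s a)(y; μ, ν) = Σ_p V y p · curl a (p; μ, ν)` for EVERY one-form `a`, `V ≥ 0`, ROW SUMS `Σ_p V y p = (L²)^s`
  (an `L^s × L^s` square of fine plaquettes tiles the coarse one) and COLUMN SUMS `Σ_y V y p ≤ (L²/L^d)^s`.  The column bound is the
  whole point and is proved by the DIGIT ARGUMENT: a backward chain from a fine plaquette is determined by its `2s` segment digits
  `(t, s)`, because at each step the block offset and the coarse site are recovered from the fine site (injectivity of §1); so the
  `L^{(d+2)s}` chains out of `y`, each of weight `L^{−ds}`, pile at most `L^{2s}` high on any fine plaquette.  (Induction from the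
  coarse end on the pair «row sums, column sums»; the naive sup bound does not induct, the column bound does.)
* §3 `weight_le`, ★★ `sum_weight_sq_le` — hence `V y p ≤ (L^{2−d})^s` and `Σ_p (V y p)² ≤ (L^{4−d})^s`: in `d = 3`, `≤ L^s`;
  `d = 4` is exactly marginal.
* §4 ★★★ `variance_curl_linAvgIter_le` — THE RUNG: for ANY random one-form whose fine plaquette curls have covariance `≤ σ²·Id`
  (lattice Maxwell at inverse coupling `β_K`: `σ² = β_K⁻¹ = g_K²`), the `s`-fold averaged plaquette has variance `≤ σ²·(L^{4−d})^s`;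
  in `d = 3` (`variance_curl_linAvgIter_le_T3`) this is `≤ g_K² L^s = g_{K−s}²` — ratio `≤ 1` in threshold units, UNIFORMLY in `K`,
  `s ≤ m + K` and the volume `2L^{m+K}` (kit j291705 measured `2/3` with the exact Maxwell covariance, below this bound `1`);
  `prob_abs_sub_ge_le_T3` is the Chebyshev form `ℙ{|plaq − mean| ≥ θ} ≤ g_{K−s}²/θ²`.

WHAT THIS IS NOT.  Not a bound for the INTERACTING SU(2) law (that is Bałaban's (71) inside the renormalisation-group densities — the
crux's located, unprinted content, typed as `AveragedTailAt` / 2′χ `AlphaInputsT3ACv3RecChi`, OPEN); not exponential tails (only the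
second moment is assumed); the lattice-Maxwell measure itself is not constructed here — its one property used is the HYPOTHESIS
`hcov`.  It certifies the route's threshold bookkeeping (`θ(K−s)` against `g_{K−s}`) at the Gaussian level and nothing more; crux r3 stays
open; no summit is proved (rung R3 record only; the Yang–Mills mass gap is untouched).

References: T. Bałaban, Commun. Math. Phys. 109 (1987) 249–301 [Balaban1987RG1] ((0.4) p.253, (0.11) p.253); CMP 98 (1985) 17–51
[Balaban1985Averaging] ((9), (14) p.19); CMP 102 (1985) 255–275 [Balaban1985UV3] ((7) p.257, (71) p.273).
-/

set_option autoImplicit false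

noncomputable section

namespace Summit.QuantumFields.YangMills.Theorems.SFWGaussianRung

open scoped BigOperators
open MeasureTheory ProbabilityTheory
open Literature.MathematicalPhysics.QuantumFieldTheory.Balaban1983to89
open Literature.MathematicalPhysics.QuantumFieldTheory.Balaban1983to89.BlockAveraging (off Idx)
open Literature.MathematicalPhysics.QuantumFieldTheory.Balaban1983to89.B10Eq47AxialChi (shiftN shiftN_zero shiftN_succ)
open Literature.MathematicalPhysics.QuantumFieldTheory.Balaban1983to89.BlockAveragingEMLProp2 (shiftN_apply)
open Summit.QuantumFields.YangMills.Theorems.AbelianEML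

variable {P : Params} {j : ℕ}

/-! ## §1 One step: the curl of the (0.4) linear average as a digit sum, and backward determinism -/

/-- **ONE STEP AS A DIGIT SUM**: `curl (linAvg04 a)(y; μ, ν) = |Idx|⁻¹ Σ_r Σ_e curl a (blockSite y r + t e_ν + s e_μ; μ, ν)`, the digits
`e = ((σ, σ′), (t, s))` carrying the two (idle) orderings of the (0.4) index set and the position in the transported `L × L` square.
[cite: Balaban1987RG1, (0.4) p.253; Balaban1985Averaging, (9)+(14) p.19] -/
theorem curlAt_linAvg04_eq_sum (a : PBond P j → ℝ) (y : Site P (j + 1)) (μ ν : Fin P.d) :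
    curlAt (linAvg04 a) y μ ν = (Fintype.card (Idx P) : ℝ)⁻¹ *
      ∑ r : Fin P.d → Fin P.L, ∑ e : (Equiv.Perm (Fin P.d) × Equiv.Perm (Fin P.d)) × (Fin P.L × Fin P.L),
        curlAt a (shiftN (shiftN (offPt y (off r)) ν (e.2.1 : ℕ)) μ (e.2.2 : ℕ)) μ ν := by
  have h0 : curlAt (linAvg04 a) y μ ν =
      linAvg04 a ⟨y, μ⟩ + linAvg04 a ⟨y.shift μ, ν⟩ - linAvg04 a ⟨y.shift ν, μ⟩ - linAvg04 a ⟨y, ν⟩ := rfl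
  rw [h0, curl_linAvg04]
  congr 1
  -- the square flux at offset `r` is the double digit sum of fine curls (abelian Stokes)
  set g : (Fin P.d → Fin P.L) → ℝ := fun r =>
    ∑ t : Fin P.L, ∑ u : Fin P.L, curlAt a (shiftN (shiftN (offPt y (off r)) ν (t : ℕ)) μ (u : ℕ)) μ ν with hg
  have hsq : ∀ i : Idx P, squareSum a y (off i.1) μ ν = g i.1 := by
    intro i
    rw [squareSum_eq_rectSum, rectSum_eq_sum_curl, hg]
    simp only
    rw [Finset.sum_range]
    refine Finset.sum_congr rfl fun t _ => ?_
    rw [Finset.sum_range]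
  have hR : ∀ r : Fin P.d → Fin P.L,
      (∑ e : (Equiv.Perm (Fin P.d) × Equiv.Perm (Fin P.d)) × (Fin P.L × Fin P.L),
        curlAt a (shiftN (shiftN (offPt y (off r)) ν (e.2.1 : ℕ)) μ (e.2.2 : ℕ)) μ ν) =
        (Fintype.card (Equiv.Perm (Fin P.d)) * Fintype.card (Equiv.Perm (Fin P.d))) • g r := by
    intro r
    rw [hg, Fintype.sum_prod_type]
    simp only [Fintype.sum_prod_type, Finset.sum_const, Finset.card_univ, Fintype.card_prod]
  rw [Finset.sum_congr rfl fun i _ => hsq i, sum_idx_fst, Finset.smul_sum]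
  exact Finset.sum_congr rfl fun r _ => (hR r).symm

/-- Torus translations are injective: `x + n e_μ = x′ + n e_μ → x = x′`. [folklore] -/
theorem shiftN_left_injective (μ : Fin P.d) (n : ℕ) : Function.Injective fun x : Site P j => shiftN x μ n := by
  intro x x' h
  funext κ
  have := congrFun h κ
  simp only [shiftN_apply] at this
  exact add_right_cancel this

/-- **BACKWARD DETERMINISM**: for a fixed digit `e`, the fine site `blockSite y r + t e_ν + s e_μ` determines the coarse site `y` AND the
block offset `r` (standing range `j + 1 ≤ m + K`). [cite: Balaban1987RG1, (0.3) p.252 (bookkeeping)] -/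
theorem step_injective (hj : j + 1 ≤ P.m + P.K) (μ ν : Fin P.d)
    (e : (Equiv.Perm (Fin P.d) × Equiv.Perm (Fin P.d)) × (Fin P.L × Fin P.L)) :
    Function.Injective fun q : Site P (j + 1) × (Fin P.d → Fin P.L) =>
      shiftN (shiftN (offPt q.1 (off q.2)) ν (e.2.1 : ℕ)) μ (e.2.2 : ℕ) := by
  intro q q' h
  have h1 := shiftN_left_injective ν (e.2.1 : ℕ) (shiftN_left_injective μ (e.2.2 : ℕ) h)
  simp only [offPt_off_eq_blockSite] at h1
  obtain ⟨hy, hr⟩ := AveragingRT.blockSite_inj hj h1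
  exact Prod.ext hy hr

/-- A nonnegative function summed over the image of an injective map is at most its total sum. [folklore] -/
theorem sum_comp_le_of_injective {α β : Type*} [Fintype α] [Fintype β] [DecidableEq β] (f : β → ℝ) (hf : ∀ b, 0 ≤ f b)
    (g : α → β) (hg : Function.Injective g) : ∑ a, f (g a) ≤ ∑ b, f b := by
  classical
  rw [← Finset.sum_image (f := f) fun a _ a' _ h => hg h]
  exact Finset.sum_le_sum_of_subset_of_nonneg (Finset.subset_univ _) fun b _ _ => hf b

/-! ## §2 `s` steps: the weight, its row sums and its column sums -/

/-- `|Idx| = L^d·(d!)²` as a real number, and it is positive. [folklore] -/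
theorem card_idx_real : (Fintype.card (Idx P) : ℝ) =
    (P.L : ℝ) ^ P.d * (Fintype.card (Equiv.Perm (Fin P.d)) * Fintype.card (Equiv.Perm (Fin P.d)) : ℕ) := by
  rw [card_idx]; push_cast; ring

/-- The digit type has `(d!)²·L²` elements. [folklore] -/
theorem card_digit : (Fintype.card ((Equiv.Perm (Fin P.d) × Equiv.Perm (Fin P.d)) × (Fin P.L × Fin P.L)) : ℝ) =
    (Fintype.card (Equiv.Perm (Fin P.d)) * Fintype.card (Equiv.Perm (Fin P.d)) : ℕ) * (P.L : ℝ) ^ 2 := by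
  simp only [Fintype.card_prod, Fintype.card_fin]; push_cast; ring

/-- **★★ THE WEIGHT OF THE `s`-FOLD AVERAGED PLAQUETTE** (standing range `s ≤ m + K`): a kernel `V ≥ 0` on (coarse site) × (fine site) with
`curl (linAvgIter s a)(y; μ, ν) = Σ_p V y p · curl a (p; μ, ν)` for every one-form `a`, row sums `(L²)^s` and column sums `≤ (L²/L^d)^s`
(the digit argument: backward chains are determined by their segment digits). [cite: Balaban1987RG1, (0.4)+(0.11) p.253; Balaban1985Averaging, (14) p.19] -/
theorem exists_weight (μ ν : Fin P.d) : ∀ s : ℕ, s ≤ P.m + P.K → ∃ V : Site P s → Site P 0 → ℝ,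
    (∀ y p, 0 ≤ V y p) ∧
    (∀ y, ∑ p, V y p = ((P.L : ℝ) ^ 2) ^ s) ∧
    (∀ p, ∑ y, V y p ≤ ((P.L : ℝ) ^ 2 / (P.L : ℝ) ^ P.d) ^ s) ∧
    (∀ (a : PBond P 0 → ℝ) (y : Site P s), curlAt (linAvgIter s a) y μ ν = ∑ p, V y p * curlAt a p μ ν)
  | 0, _ => by
    classical
    refine ⟨fun y p => if y = p then 1 else 0, fun y p => by positivity, fun y => ?_, fun p => ?_, fun a y => ?_⟩
    · simp [Finset.sum_ite_eq]
    · simp [Finset.sum_ite_eq']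
    · simp [Finset.sum_ite_eq, linAvgIter]
  | s + 1, hs => by
    classical
    obtain ⟨V, hV0, hrow, hcol, hrep⟩ := exists_weight μ ν s (Nat.le_of_succ_le hs)
    -- constants: `c = |Idx|⁻¹ = (L^d (d!)²)⁻¹`, the digit count `(d!)² L²`
    set c : ℝ := (Fintype.card (Idx P) : ℝ)⁻¹ with hc
    have hL : (0 : ℝ) < P.L := Nat.cast_pos.mpr P.L_pos
    have hnp0 : (0 : ℝ) < ((Fintype.card (Equiv.Perm (Fin P.d)) * Fintype.card (Equiv.Perm (Fin P.d)) : ℕ) : ℝ) := by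
      exact_mod_cast Nat.mul_pos Fintype.card_pos Fintype.card_pos
    have hcI : c = ((P.L : ℝ) ^ P.d * ((Fintype.card (Equiv.Perm (Fin P.d)) * Fintype.card (Equiv.Perm (Fin P.d)) : ℕ) : ℝ))⁻¹ := by
      rw [hc, card_idx_real]
    have hc0 : 0 ≤ c := by rw [hcI]; positivity
    -- the one-step map (opaque name with its defining equation) and the new weight
    obtain ⟨step, hstep⟩ : ∃ step : Site P (s + 1) → (Fin P.d → Fin P.L) →
        (Equiv.Perm (Fin P.d) × Equiv.Perm (Fin P.d)) × (Fin P.L × Fin P.L) → Site P s,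
        ∀ y r e, step y r e = shiftN (shiftN (offPt y (off r)) ν (e.2.1 : ℕ)) μ (e.2.2 : ℕ) := ⟨_, fun _ _ _ => rfl⟩
    have hinj : ∀ e : (Equiv.Perm (Fin P.d) × Equiv.Perm (Fin P.d)) × (Fin P.L × Fin P.L),
        Function.Injective fun q : Site P (s + 1) × (Fin P.d → Fin P.L) => step q.1 q.2 e := by
      intro e
      have hfun : (fun q : Site P (s + 1) × (Fin P.d → Fin P.L) => step q.1 q.2 e) =
          fun q => shiftN (shiftN (offPt q.1 (off q.2)) ν (e.2.1 : ℕ)) μ (e.2.2 : ℕ) := funext fun q => hstep _ _ _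
      rw [hfun]
      exact step_injective hs μ ν e
    refine ⟨fun y p => c * ∑ r, ∑ e, V (step y r e) p, fun y p => ?_, fun y => ?_, fun p => ?_, fun a y => ?_⟩
    · -- nonnegativity
      exact mul_nonneg hc0 (Finset.sum_nonneg fun r _ => Finset.sum_nonneg fun e _ => hV0 _ _)
    · -- row sums: `c · L^d · (d!)² L² · (L²)^s = (L²)^{s+1}`
      rw [← Finset.mul_sum]
      have h1 : ∑ p : Site P 0, ∑ r : Fin P.d → Fin P.L,
          ∑ e : (Equiv.Perm (Fin P.d) × Equiv.Perm (Fin P.d)) × (Fin P.L × Fin P.L), V (step y r e) p =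
          ∑ r : Fin P.d → Fin P.L, ∑ e : (Equiv.Perm (Fin P.d) × Equiv.Perm (Fin P.d)) × (Fin P.L × Fin P.L),
            ∑ p : Site P 0, V (step y r e) p := by
        rw [Finset.sum_comm]
        exact Finset.sum_congr rfl fun r _ => Finset.sum_comm
      rw [h1]
      simp only [hrow, Finset.sum_const, Finset.card_univ, Fintype.card_fun, Fintype.card_fin, nsmul_eq_mul, Nat.cast_pow]
      rw [card_digit, hcI]
      field_simp
      ring
    · -- column sums: `Σ_y V' y p = c Σ_e Σ_{(y,r)} V (step y r e) p ≤ c Σ_e Σ_z V z p ≤ (L²/L^d)·(L²/L^d)^s`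
      have hkey : ∀ e : (Equiv.Perm (Fin P.d) × Equiv.Perm (Fin P.d)) × (Fin P.L × Fin P.L),
          ∑ y : Site P (s + 1), ∑ r : Fin P.d → Fin P.L, V (step y r e) p ≤ ((P.L : ℝ) ^ 2 / (P.L : ℝ) ^ P.d) ^ s := by
        intro e
        rw [← Fintype.sum_prod_type']
        exact (sum_comp_le_of_injective (fun z => V z p) (fun z => hV0 z p)
          (fun q : Site P (s + 1) × (Fin P.d → Fin P.L) => step q.1 q.2 e) (hinj e)).trans (hcol p)
      have h1 : ∑ y : Site P (s + 1), c * ∑ r : Fin P.d → Fin P.L,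
          ∑ e : (Equiv.Perm (Fin P.d) × Equiv.Perm (Fin P.d)) × (Fin P.L × Fin P.L), V (step y r e) p =
          c * ∑ e : (Equiv.Perm (Fin P.d) × Equiv.Perm (Fin P.d)) × (Fin P.L × Fin P.L),
            ∑ y : Site P (s + 1), ∑ r : Fin P.d → Fin P.L, V (step y r e) p := by
        rw [← Finset.mul_sum]
        congr 1
        calc ∑ y : Site P (s + 1), ∑ r : Fin P.d → Fin P.L,
              ∑ e : (Equiv.Perm (Fin P.d) × Equiv.Perm (Fin P.d)) × (Fin P.L × Fin P.L), V (step y r e) p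
            = ∑ y : Site P (s + 1), ∑ e : (Equiv.Perm (Fin P.d) × Equiv.Perm (Fin P.d)) × (Fin P.L × Fin P.L),
                ∑ r : Fin P.d → Fin P.L, V (step y r e) p := Finset.sum_congr rfl fun y _ => Finset.sum_comm
          _ = _ := Finset.sum_comm
      rw [h1]
      calc c * ∑ e : (Equiv.Perm (Fin P.d) × Equiv.Perm (Fin P.d)) × (Fin P.L × Fin P.L),
              ∑ y : Site P (s + 1), ∑ r : Fin P.d → Fin P.L, V (step y r e) p
          ≤ c * ∑ _e : (Equiv.Perm (Fin P.d) × Equiv.Perm (Fin P.d)) × (Fin P.L × Fin P.L),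
              ((P.L : ℝ) ^ 2 / (P.L : ℝ) ^ P.d) ^ s :=
            mul_le_mul_of_nonneg_left (Finset.sum_le_sum fun e _ => hkey e) hc0
        _ = ((P.L : ℝ) ^ 2 / (P.L : ℝ) ^ P.d) ^ (s + 1) := by
            have hscal : c * (((Fintype.card (Equiv.Perm (Fin P.d)) * Fintype.card (Equiv.Perm (Fin P.d)) : ℕ) : ℝ) *
                (P.L : ℝ) ^ 2) = (P.L : ℝ) ^ 2 / (P.L : ℝ) ^ P.d := by
              rw [hcI]
              field_simp
            rw [Finset.sum_const, Finset.card_univ, nsmul_eq_mul, card_digit, ← mul_assoc, hscal]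
            ring
    · -- the representation: one step (§1) at level `s`, then the induction hypothesis at every `step y r e`
      rw [linAvgIter_succ, curlAt_linAvg04_eq_sum, ← hc]
      simp only [← hstep, hrep a]
      rw [Finset.mul_sum]
      simp_rw [Finset.mul_sum, Finset.sum_mul]
      -- both sides are `Σ_r Σ_e Σ_p (c · V · curl)` up to the order of summation and of the factors
      calc ∑ r : Fin P.d → Fin P.L, ∑ e : (Equiv.Perm (Fin P.d) × Equiv.Perm (Fin P.d)) × (Fin P.L × Fin P.L),
              ∑ p : Site P 0, c * (V (step y r e) p * curlAt a p μ ν)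
          = ∑ r : Fin P.d → Fin P.L, ∑ p : Site P 0,
              ∑ e : (Equiv.Perm (Fin P.d) × Equiv.Perm (Fin P.d)) × (Fin P.L × Fin P.L), c * V (step y r e) p * curlAt a p μ ν := by
            refine Finset.sum_congr rfl fun r _ => ?_
            rw [Finset.sum_comm]
            exact Finset.sum_congr rfl fun p _ => Finset.sum_congr rfl fun e _ => by ring
        _ = ∑ p : Site P 0, ∑ r : Fin P.d → Fin P.L,
              ∑ e : (Equiv.Perm (Fin P.d) × Equiv.Perm (Fin P.d)) × (Fin P.L × Fin P.L), c * V (step y r e) p * curlAt a p μ ν :=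
            Finset.sum_comm

/-! ## §3 Pointwise and quadratic bounds on the weight -/

/-- Every entry of a weight with nonnegative entries and column sums `≤ B` is `≤ B`. [folklore] -/
theorem weight_le {s : ℕ} {V : Site P s → Site P 0 → ℝ} {B : ℝ} (hV0 : ∀ y p, 0 ≤ V y p) (hcol : ∀ p, ∑ y, V y p ≤ B)
    (y : Site P s) (p : Site P 0) : V y p ≤ B :=
  (Finset.single_le_sum (f := fun y' => V y' p) (fun y' _ => hV0 y' p) (Finset.mem_univ y)).trans (hcol p)

/-- **★★ THE QUADRATIC BOUND**: row sums `R` and column sums `≤ B` give `Σ_p (V y p)² ≤ B·R`; for the (0.4) weight of §2,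
`Σ_p (V y p)² ≤ (L²/L^d)^s·(L²)^s = (L^{4−d})^s`. [folklore] -/
theorem sum_weight_sq_le {s : ℕ} {V : Site P s → Site P 0 → ℝ} {R B : ℝ} (hV0 : ∀ y p, 0 ≤ V y p) (hrow : ∀ y, ∑ p, V y p = R)
    (hcol : ∀ p, ∑ y, V y p ≤ B) (y : Site P s) : ∑ p, V y p ^ 2 ≤ B * R := by
  calc ∑ p, V y p ^ 2 = ∑ p, V y p * V y p := Finset.sum_congr rfl fun p _ => sq _
    _ ≤ ∑ p, B * V y p := Finset.sum_le_sum fun p _ => mul_le_mul_of_nonneg_right (weight_le hV0 hcol y p) (hV0 y p)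
    _ = B * R := by rw [← Finset.mul_sum, hrow]

/-- **THE `s`-FOLD AVERAGED PLAQUETTE IS A FIXED LINEAR COMBINATION OF FINE PLAQUETTES WITH `Σ V² ≤ (L^{4−d})^s`** (standing range). For
`d = 3`: `Σ V² ≤ L^s`; `d = 4` is marginal (`≤ 1`). [cite: Balaban1987RG1, (0.4)+(0.11) p.253] -/
theorem exists_weight_sq {s : ℕ} (hs : s ≤ P.m + P.K) (μ ν : Fin P.d) : ∃ V : Site P s → Site P 0 → ℝ,
    (∀ y p, 0 ≤ V y p) ∧ (∀ y p, V y p ≤ ((P.L : ℝ) ^ 2 / (P.L : ℝ) ^ P.d) ^ s) ∧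
    (∀ y, ∑ p, V y p ^ 2 ≤ ((P.L : ℝ) ^ 2 / (P.L : ℝ) ^ P.d) ^ s * ((P.L : ℝ) ^ 2) ^ s) ∧
    (∀ (a : PBond P 0 → ℝ) (y : Site P s), curlAt (linAvgIter s a) y μ ν = ∑ p, V y p * curlAt a p μ ν) := by
  obtain ⟨V, hV0, hrow, hcol, hrep⟩ := exists_weight μ ν s hs
  exact ⟨V, hV0, weight_le hV0 hcol, sum_weight_sq_le hV0 hrow hcol, hrep⟩

/-! ## §4 The rung: the variance of the averaged plaquette under any law with plaquette covariance `≤ σ²` -/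

section Variance

variable {Ω : Type*} [MeasurableSpace Ω]

/-- **★★★ THE GAUSSIAN RUNG (every `d`)**: if a random one-form `A` on the finest lattice has plaquette curls with covariance `≤ σ²·Id`
in the plane `(μ, ν)` — `Var(Σ_p c_p·curl A(p; μ, ν)) ≤ σ²·Σ_p c_p²` for every coefficient vector `c` (lattice Maxwell at inverse coupling
`β`: `σ² = β⁻¹`) — then the `s`-fold (0.4)-averaged plaquette has `Var ≤ σ²·(L²/L^d)^s·(L²)^s = σ²·(L^{4−d})^s`, uniformly in the volume
(standing range `s ≤ m + K`). [cite: Balaban1985UV3, (7) p.257 and (71) p.273 (the thresholds this calibrates)] -/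
theorem variance_curl_linAvgIter_le (Pr : Measure Ω) (A : Ω → PBond P 0 → ℝ) (μ ν : Fin P.d) {σ2 : ℝ} (hσ : 0 ≤ σ2)
    (hcov : ∀ c : Site P 0 → ℝ, variance (fun ω => ∑ p, c p * curlAt (A ω) p μ ν) Pr ≤ σ2 * ∑ p, c p ^ 2)
    {s : ℕ} (hs : s ≤ P.m + P.K) (y : Site P s) :
    variance (fun ω => curlAt (linAvgIter s (A ω)) y μ ν) Pr ≤ σ2 * (((P.L : ℝ) ^ 2 / (P.L : ℝ) ^ P.d) ^ s * ((P.L : ℝ) ^ 2) ^ s) := by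
  obtain ⟨V, -, -, hsq, hrep⟩ := exists_weight_sq hs μ ν
  have hfun : (fun ω => curlAt (linAvgIter s (A ω)) y μ ν) = fun ω => ∑ p, V y p * curlAt (A ω) p μ ν :=
    funext fun ω => hrep (A ω) y
  rw [hfun]
  exact (hcov (V y)).trans (mul_le_mul_of_nonneg_left (hsq y) hσ)

/-- **★★★ THE GAUSSIAN RUNG IN `d = 3`** (the route's own dimension, `T3Family`): `Var(s-fold averaged plaquette) ≤ σ²·L^s`; with
`σ² = g_K² = γL^{−K}` this is `g_{K−s}²` — ratio `≤ 1` in the units of Bałaban's threshold `θ(K−s) = g_{K−s} p(g_{K−s})`, UNIFORMLY in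
`K`, `s ≤ m + K` and the volume (kit j291705: `2/3` numerically). [cite: Balaban1985UV3, (7) p.257 and (71) p.273] -/
theorem variance_curl_linAvgIter_le_T3 (hd : P.d = 3) (Pr : Measure Ω) (A : Ω → PBond P 0 → ℝ) (μ ν : Fin P.d) {σ2 : ℝ}
    (hσ : 0 ≤ σ2) (hcov : ∀ c : Site P 0 → ℝ, variance (fun ω => ∑ p, c p * curlAt (A ω) p μ ν) Pr ≤ σ2 * ∑ p, c p ^ 2)
    {s : ℕ} (hs : s ≤ P.m + P.K) (y : Site P s) :
    variance (fun ω => curlAt (linAvgIter s (A ω)) y μ ν) Pr ≤ σ2 * (P.L : ℝ) ^ s := by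
  have hL : (P.L : ℝ) ≠ 0 := (Nat.cast_pos.mpr P.L_pos).ne'
  have h := variance_curl_linAvgIter_le Pr A μ ν hσ hcov hs y
  have hconst : ((P.L : ℝ) ^ 2 / (P.L : ℝ) ^ P.d) ^ s * ((P.L : ℝ) ^ 2) ^ s = (P.L : ℝ) ^ s := by
    rw [hd, ← mul_pow, show (P.L : ℝ) ^ 2 / (P.L : ℝ) ^ 3 * (P.L : ℝ) ^ 2 = P.L by field_simp]
  rwa [hconst] at h

/-- **Chebyshev form of the rung in `d = 3`**: `ℙ{|plaq_s − 𝔼 plaq_s| ≥ θ} ≤ σ²L^s/θ²` for the `s`-fold averaged plaquette of a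
square-integrable random one-form with plaquette covariance `≤ σ²` (probability law). [folklore] -/
theorem prob_abs_sub_ge_le_T3 (hd : P.d = 3) (Pr : Measure Ω) [IsProbabilityMeasure Pr] (A : Ω → PBond P 0 → ℝ) (μ ν : Fin P.d)
    {σ2 : ℝ} (hσ : 0 ≤ σ2) (hcov : ∀ c : Site P 0 → ℝ, variance (fun ω => ∑ p, c p * curlAt (A ω) p μ ν) Pr ≤ σ2 * ∑ p, c p ^ 2)
    {s : ℕ} (hs : s ≤ P.m + P.K) (y : Site P s) (hX : MemLp (fun ω => curlAt (linAvgIter s (A ω)) y μ ν) 2 Pr) {θ : ℝ}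
    (hθ : 0 < θ) :
    Pr {ω | θ ≤ |curlAt (linAvgIter s (A ω)) y μ ν - ∫ ω', curlAt (linAvgIter s (A ω')) y μ ν ∂Pr|} ≤
      ENNReal.ofReal (σ2 * (P.L : ℝ) ^ s / θ ^ 2) := by
  refine (meas_ge_le_variance_div_sq hX hθ).trans ?_
  gcongr
  exact variance_curl_linAvgIter_le_T3 hd Pr A μ ν hσ hcov hs y

end Variance

end Summit.QuantumFields.YangMills.Theorems.SFWGaussianRung

end

/-! ## §5 Exponential tails: the per-plaquette factor `e^{−p²/2}` at every height under a sub-Gaussian law (APPEND, same seat) -/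

namespace Summit.QuantumFields.YangMills.Theorems.SFWGaussianRung

open scoped BigOperators NNReal
open MeasureTheory ProbabilityTheory
open Literature.MathematicalPhysics.QuantumFieldTheory.Balaban1983to89
open Summit.QuantumFields.YangMills.Theorems.AbelianEML

variable {P : Params} {Ω : Type*} [MeasurableSpace Ω]

/-- A sub-Gaussian moment-generating function with parameter `c` is one with any larger parameter `c' ≥ c`. [folklore] -/
theorem hasSubgaussianMGF_mono {Pr : Measure Ω} {X : Ω → ℝ} {c c' : ℝ≥0} (h : HasSubgaussianMGF X c Pr) (hcc : c ≤ c') :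
    HasSubgaussianMGF X c' Pr := by
  refine ⟨h.integrable_exp_mul, fun t => (h.mgf_le t).trans (Real.exp_le_exp.mpr ?_)⟩
  have : (c : ℝ) ≤ c' := NNReal.coe_le_coe.mpr hcc
  have ht : 0 ≤ t ^ 2 := sq_nonneg t
  nlinarith

/-- **★★★ SUB-GAUSSIAN PROPAGATION TO EVERY HEIGHT (`d = 3`)**: if every fixed linear combination `Σ_p c_p·curl A(p; μ, ν)` of the fine
plaquette curls is sub-Gaussian with variance proxy `σ²·Σ_p c_p²` (the centred lattice-Maxwell field at `β = σ⁻²` is the model), then the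
`s`-fold (0.4)-averaged plaquette is sub-Gaussian with variance proxy `σ²·L^s` (standing range `s ≤ m + K`), uniformly in the volume.
[cite: Balaban1985UV3, (7) p.257 and (71) p.273 (the thresholds this calibrates)] -/
theorem hasSubgaussianMGF_curl_linAvgIter_T3 (hd : P.d = 3) (Pr : Measure Ω) (A : Ω → PBond P 0 → ℝ) (μ ν : Fin P.d) (σ2 : ℝ≥0)
    (hsub : ∀ c : Site P 0 → ℝ, HasSubgaussianMGF (fun ω => ∑ p, c p * curlAt (A ω) p μ ν) (σ2 * (∑ p, c p ^ 2).toNNReal) Pr)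
    {s : ℕ} (hs : s ≤ P.m + P.K) (y : Site P s) :
    HasSubgaussianMGF (fun ω => curlAt (linAvgIter s (A ω)) y μ ν) (σ2 * (P.L : ℝ≥0) ^ s) Pr := by
  obtain ⟨V, -, -, hsq, hrep⟩ := exists_weight_sq hs μ ν
  have hfun : (fun ω => curlAt (linAvgIter s (A ω)) y μ ν) = fun ω => ∑ p, V y p * curlAt (A ω) p μ ν :=
    funext fun ω => hrep (A ω) y
  rw [hfun]
  refine hasSubgaussianMGF_mono (hsub (V y)) (mul_le_mul_right ?_ σ2)
  have hconst : ((P.L : ℝ) ^ 2 / (P.L : ℝ) ^ P.d) ^ s * ((P.L : ℝ) ^ 2) ^ s = (P.L : ℝ) ^ s := by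
    rw [hd, ← mul_pow, show (P.L : ℝ) ^ 2 / (P.L : ℝ) ^ 3 * (P.L : ℝ) ^ 2 = P.L by field_simp]
  have h1 : ∑ p, V y p ^ 2 ≤ (P.L : ℝ) ^ s := hconst ▸ hsq y
  rw [← NNReal.coe_le_coe, Real.coe_toNNReal _ (Finset.sum_nonneg fun p _ => sq_nonneg _)]
  simpa using h1

/-- **★★★ THE PER-PLAQUETTE LARGE-FIELD FACTOR AT EVERY HEIGHT, GAUSSIAN INSTANCE (`d = 3`)**: under the sub-Gaussian hypothesis with
`σ² = g_K² > 0`, the `s`-fold averaged plaquette exceeds `g_{K−s}·p` (`g_{K−s}² := σ²L^s = g_K² L^s`) with probability `≤ e^{−p²/2}` for every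
`p ≥ 0`, every height `s ≤ m + K` and every volume — the shape `e^{−c·p(g_{K−s})²}` of the route's `PerHeightLargeFieldFactor` and of
[Balaban1985UV3] (71), `K`-uniformly, in the linearised theory (the lower tail is the same bound applied to `−A`). [cite: Balaban1985UV3, (71) p.273] -/
theorem measureReal_curl_linAvgIter_ge_le_T3 (hd : P.d = 3) (Pr : Measure Ω) (A : Ω → PBond P 0 → ℝ) (μ ν : Fin P.d) {σ2 : ℝ≥0}
    (hσ : σ2 ≠ 0)
    (hsub : ∀ c : Site P 0 → ℝ, HasSubgaussianMGF (fun ω => ∑ p, c p * curlAt (A ω) p μ ν) (σ2 * (∑ p, c p ^ 2).toNNReal) Pr)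
    {s : ℕ} (hs : s ≤ P.m + P.K) (y : Site P s) {pv : ℝ} (hpv : 0 ≤ pv) :
    Pr.real {ω | Real.sqrt ((σ2 : ℝ) * (P.L : ℝ) ^ s) * pv ≤ curlAt (linAvgIter s (A ω)) y μ ν} ≤ Real.exp (-pv ^ 2 / 2) := by
  have h := hasSubgaussianMGF_curl_linAvgIter_T3 hd Pr A μ ν σ2 hsub hs y
  set g2 : ℝ := (σ2 : ℝ) * (P.L : ℝ) ^ s with hg2
  have hg2 : 0 < g2 := mul_pos (NNReal.coe_pos.mpr (pos_iff_ne_zero.mpr hσ)) (pow_pos (Nat.cast_pos.mpr P.L_pos) s)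
  have hcoe : ((σ2 * (P.L : ℝ≥0) ^ s : ℝ≥0) : ℝ) = g2 := by push_cast; ring
  have hθ : 0 ≤ Real.sqrt g2 * pv := mul_nonneg (Real.sqrt_nonneg _) hpv
  have := h.measure_ge_le hθ
  rw [hcoe] at this
  refine this.trans (Real.exp_le_exp.mpr (le_of_eq ?_))
  rw [mul_pow, Real.sq_sqrt hg2.le]
  field_simp

end Summit.QuantumFields.YangMills.Theorems.SFWGaussianRung
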